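import Literature.MathematicalPhysics.QuantumFieldTheory.Balaban1983to89.B6DomainChangeP2134Sizes
import Literature.MathematicalPhysics.QuantumFieldTheory.Balaban1983to89.B6CommutatorZoneKernels
import Literature.MathematicalPhysics.QuantumFieldTheory.Balaban1983to89.B6GluedLegsWindow
import Literature.MathematicalPhysics.QuantumFieldTheory.Balaban1983to89.B6ZoneByPartsV1
import Literature.MathematicalPhysics.QuantumFieldTheory.Balaban1983to89.B6MemberTorusTDomainsV1
import HarnessLib

/-!
# [B6] Prop. 2.6, (2.92) LINE 3 `ζ_□(∂P∂* − ∂P̃_□∂*)h_□` ON THE WINDOW OF A MEMBER — p38's size theorem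
`B6DomainChangeP2134Sizes.line3P_hasMajorant_gk_zone_cut` INSTANTIATED with the p22 scalar factors (`B6ScalarFactorsChartV1`), the window ring data
(`B6ScalarAgreeV1Chart`), the glued geometry and the cut legs (`B6GluedDistWindow`, `B6GluedLegsWindow`), the zone kernels (`B6ZoneKernelsV1`) and the
by-parts column kernel (`B6ZoneByPartsV1` + p38's `B6CommutatorZoneKernels.commZone_right_bd`)

statement-level skeleton of published theorems with citation tags; proofs where landed; nothing here is a claim about the Yang–Mills mass gap

[tag: formalized_from_source] (assembly ours; print p. 239 (2.92) line 3 *"+ Σ_{□⊂Λ_j} ζ_□(∂P∂* − ∂P_□∂*)h_□"*, p. 238 *"the terms with the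
commutator … give a factor O(M⁻¹)"*, (2.134) p. 247 [cite: Balaban1984PropagatorsII, (2.92) p.239, (2.134) p.247, p.238].)

## What

`line3_window`: for a global V1 torus `T_η` with block family `D` (ANY frame), a window (corner `x₀`, member torus `t.P`) and ANY member block family
`D₁` whose levels agree with `D` through the window (`hlevW`) and whose block sizes divide `x₀` (`hal`), for a cut-off `χ` supported in the window
(margin 3) with `χ = 1` off a zone `N` of blocks, sizes `s₁` (first differences × len), `s₂` (second differences × len²), `s_b` (block oscillation),
jumps of margin 1, and bond cut-offs `ζ`, `h` (`|·| ≤ 1`, margin 1) whose blocks are at glued distance `≥ M₀` from the zone: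
`ζ·(∂(G′SG′ − G̃′_□S̃_□G̃′_□)∂*)·h` has the all-pairs block majorant
`C_D·e^{−δ′M₀/96}·cf²/len(y)²·e^{−δ′d′(y,y″)/192}` on the glued geometry `geomW` (`d′ ≤ d_T`, `= d_T` far from the faces), `δ′ = δ − 2κ`,
with `C_D = CDgk(…)` of p38 explicit in `d, L`, the factor constant `C`, the sizes, the torus profile `K_p` and `|blocks of T_□|`.
Here `G′SG′ = onFun (1 − R E)` (`B6ScalarFactorsChartV1.onFun_oneSubRE_eq`) and `G̃′_□S̃_□G̃′_□` is the window transplant of the member's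
`G′_□S_□G′_□` (`B6ScalarAgreeV1Chart.transplant_GSG`; `= P_□` of the member by `B6MemberTorusTDomainsV1.tsV1_P_chart`).

No measure, no Yang–Mills claim.
-/

open scoped BigOperators
open Finset

namespace Literature.MathematicalPhysics.QuantumFieldTheory.Balaban1983to89.B6Line3WindowV1

open B4Reflection242 (boxDom)
open B4Sect5Torus (IsPseudoDist)
open B6MultiLevelBoxOperator (N0)
open B6MultiLevelTorusOperator (TDomains)
open B6Geom246MultiLevelBox (bset)
open B8Ineq192MultiLevelTorus (geomTB geomTB_len geomTB_M geomTB_R)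
open B6RandomWalk (HasMajorant BlockSupp hasMajorant_mono hasMajorant_add)
open B6RandomWalkHom (HasMajorantHom hasMajorantHom_mono)
open B6Ineq2133TwoScaleV1 (onFun onFun_apply)
open B6SectAOperatorsV1 (dE dsE)
open B6Prop26Gluing (mulOp mulOp_apply)
open B6Prop26ReachTransplant (transplant transplant_apply restrictOp extendOp)
open B6GlobalChartV1 (PV toBox blkV1)
open B6ScalarFactorsChartV1 (chartOp chartOp_mul blkS blkV1_eq_blkS GpV SV DpV factors_V1_TB onFun_oneSubRE_eq)
open B6AgreeLapV1Chart (eS eB DeepS DeepB deepS_mono cS cB mem_cB_W onFun_comp onFun_smul onFun_sub onFun_id)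
open B6Prop25TwoScaleCensus (TSIdx)
open B6DomainChange (Profile)
open B6GluedDistWindow (geomW geomW_dist geomW_len isPseudoDist_W distW_nonneg distW_le_distT profileW transferW hasMajorant_member_W)
open B6GluedLegsWindow (hasMajorantHom_cutLeft_W hasMajorantHom_cutRight_W dE_extendOp_apply restrictOp_dsE_eq)
open B6ZoneKernelsV1 (hasMajorant_glob_W' hasMajorantHom_glob_W_SY hasMajorantHom_glob_W_YS hasMajorantHom_mulOp_left hasMajorantHom_mulOp_right
  zoneKernel_W)
open B6ZoneByPartsV1 (Fsh csχ vχ Vavg shInv shInv_tt shInv_ff Kop_byParts' abs_csχ abs_vχ_le hasMajorant_Vavg hasMajorant_mul_Fsh_W)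
open B6DomainChangeP2134Sizes (CDgk line3P_hasMajorant_gk_zone_cut)
open B6CommutatorZoneKernels (commZone_right_bd hasMajorant_mulOp_diag)

variable {d ℓ : ℕ} {m K : ℕ} {hd : 1 ≤ d + 1} {hL : Odd (ℓ + 1) ∧ 1 < ℓ + 1}

/-! ## §1  Bookkeeping: p38's `mulOp` is ours; kernel reshaping to the weight `w = len/|c_f|` -/

/-- p38's multiplication operator (`B9Thm37Sum.mulOp`) is the gluing file's `mulOp`. [folklore] -/
private theorem mulOp9_eq {X : Type} (h : X → ℝ) : B9Thm37Sum.mulOp h = mulOp h := rfl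

/-- `c⁻²·C·len² = C·(len/|c|)²`. [folklore] -/
private theorem k_sq {c : ℝ} (hc : c ≠ 0) (C l : ℝ) : (c ^ 2)⁻¹ * C * l ^ 2 = C * (l / |c|) ^ 2 := by
  rw [div_pow, sq_abs]; field_simp

/-- `|c|⁻¹·C·len = C·(len/|c|)`. [folklore] -/
private theorem k_one {c : ℝ} (C l : ℝ) : |c|⁻¹ * C * l = C * (l / |c|) := by
  rw [div_eq_mul_inv]; ring

/-- `c⁴·C·len⁻⁴ = C·((len/|c|)⁴)⁻¹`. [folklore] -/
private theorem k_four {c : ℝ} (hc : c ≠ 0) (C : ℝ) {l : ℝ} (hl : l ≠ 0) : c ^ 4 * C * (l ^ 4)⁻¹ = C * ((l / |c|) ^ 4)⁻¹ := by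
  have h4 : |c| ^ 4 = c ^ 4 := by rw [show (4 : ℕ) = 2 * 2 from rfl, pow_mul, sq_abs, ← pow_mul]
  rw [div_pow, h4]; field_simp

/-- `e^{−δd} ≤ e^{−δ′d}` for `δ′ ≤ δ`, `d ≥ 0`. [folklore] -/
private theorem exp_rate_mono {δ δ' x : ℝ} (h : δ' ≤ δ) (hx : 0 ≤ x) : Real.exp (-(δ * x)) ≤ Real.exp (-(δ' * x)) :=
  Real.exp_le_exp.2 (by nlinarith)

/-! ## §2  Line 3 on the window -/

section Main

set_option maxHeartbeats 1600000 in
/-- **(2.92) LINE 3 ON THE WINDOW OF A MEMBER, ALL HYPOTHESES OF p38's SIZE THEOREM DISCHARGED FROM THE V1 DATA** except the cube bookkeeping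
(`χ`, its zone `N` and sizes, the column cut `c_L`, the bond cut-offs `ζ, h` and their depth `M₀`), which stay displayed in p38's form.
Constants: `B₁ = B_S = C`, `C₁ = (d+1)C` (`C, δ, M₁` of `factors_V1_TB`), `Λ = L^{2+(k₁−j_lo)}`, `δ′ = δ − 2κ`,
`θ = (d+1)(s₁C(1+e^δ) + s₂C) + s_bC`, `θ₂ = 2(d+1)·Λ·(|c_f|s₁)·(e^{1+δ}K_p(1)|c_f|⁻¹((d+1)|c_f|⁻¹C)|c_f|) + Λ²((d+1)s₂ + s_b)C`,
`K_x = K_p(δ′/192)·(1 + |blocks of T_□|)`. [cite: Balaban1984PropagatorsII, (2.92) p.239 line 3, (2.134) p.247, p.238; assembly ours] -/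
theorem line3_window (d ℓ : ℕ) (hd : 1 ≤ d + 1) (hL : Odd (ℓ + 1) ∧ 1 < ℓ + 1) :
    ∃ M₁ δ C : ℝ, 0 < M₁ ∧ 0 < δ ∧ 0 < C ∧
      ∀ (m K : ℕ) {Mh k R : ℕ} {P' : Fin (d + 1) → ℕ} (hN : ∀ μ, N0 ℓ Mh k P' μ = (PV d ℓ m K hd hL).sitesPerDir 0)
        (D : TDomains d ℓ Mh k P' R) (hk : k ≤ m + K)
        {a₀ a₁ : ℝ} {t : TSIdx d (ℓ + 1) hd hL a₀ a₁} {x₀ : Fin (d + 1) → ℤ}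
        (hx₀ : ∀ μ, 0 ≤ x₀ μ) (hfit : ∀ μ, x₀ μ + (t.P.sitesPerDir 0 : ℕ) ≤ ((PV d ℓ m K hd hL).sitesPerDir 0 : ℕ))
        {Mh₁ k₁ R₁ : ℕ} {P₁ : Fin (d + 1) → ℕ} (hN₁ : ∀ μ, N0 ℓ Mh₁ k₁ P₁ μ = (PV d ℓ t.m t.K hd hL).sitesPerDir 0)
        (D₁ : TDomains d ℓ Mh₁ k₁ P₁ R₁)
        (hlevW : ∀ x ∈ DeepS t x₀ 0, D₁.lev (toBox hN₁ (eS t x₀ x) : Fin (d + 1) → ℤ) = D.lev (toBox hN x))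
        (hal : ∀ μ, (((ℓ + 1) ^ k₁ : ℕ) : ℤ) ∣ x₀ μ) (hk₁ : k₁ ≤ t.m + t.K)
        {jlo : ℕ} (hlo : ∀ z : ↥(boxDom (N0 ℓ Mh₁ k₁ P₁)), jlo ≤ D₁.lev z.1) (hjlo : jlo ≤ k₁)
        (hP4 : ∀ μ, 4 ≤ P' μ) (hR : 2 * (ℓ + 1) ≤ R) (hM : M₁ ≤ ((ℓ : ℝ) + 1) * Mh)
        (hMh₁ : 1 ≤ Mh₁) (hP₁ : ∀ μ, 4 ≤ P₁ μ) (hR₁ : 2 * (ℓ + 1) ≤ R₁) (hM' : M₁ ≤ ((ℓ : ℝ) + 1) * Mh₁)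
        (hRM : 1 ≤ R * ((ℓ + 1) * Mh))
        {κ : ℝ} (hκ : 0 ≤ κ) (hκRM : Real.log ((ℓ : ℝ) + 1) ≤ κ * ((geomTB D).R * (geomTB D).M)) (hκδ : 8 * κ ≤ δ)
        {Kp : ℝ → ℝ} (hPrT : Profile (geomTB D).dist (fun a : ↥(bset D.toDomains) => a) Kp) (hKp0 : ∀ a, 0 < a → 0 ≤ Kp a)
        (hKanti : ∀ a b, 0 < a → a ≤ b → Kp b ≤ Kp a)
        {cf : ℝ} (hcf : cf ≠ 0) (χ cL : Site (PV d ℓ m K hd hL) 0 → ℝ) (N : Finset ↥(bset D.toDomains)) (hNne : N.Nonempty)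
        (hχ0 : ∀ x, 0 ≤ χ x) (hχ1 : ∀ x, χ x ≤ 1) (hχN : ∀ x, blkS hN D x ∉ N → χ x = 1)
        (hχ3 : ∀ x, χ x ≠ 0 → x ∈ DeepS t x₀ 3)
        (hχjump : ∀ b : PBond (PV d ℓ m K hd hL) 0, χ b.tgt ≠ χ b.src → b.src ∈ DeepS t x₀ 1)
        {s₁ s₂ sb : ℝ} (hs₁ : 0 ≤ s₁) (hs₂ : 0 ≤ s₂) (hsb : 0 ≤ sb)
        (hd1 : ∀ b : PBond (PV d ℓ m K hd hL) 0, |χ b.tgt - χ b.src| * (geomTB D).len (blkV1 hN D b) ≤ s₁)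
        (hd1' : ∀ (e : Fin (d + 1) × Bool) (x : Site (PV d ℓ m K hd hL) 0), |χ x - χ (shInv e x)| * (geomTB D).len (blkS hN D x) ≤ s₁)
        (hd2 : ∀ (y : Site (PV d ℓ m K hd hL) 0) (μ : Fin (d + 1)),
          |χ (y.shift μ) - 2 * χ y + χ (y.unshift μ)| * (geomTB D).len (blkS hN D y) ^ 2 ≤ s₂)
        (hdb : ∀ x y : Site (PV d ℓ m K hd hL) 0, blkS hN D x = blkS hN D y → |χ x - χ y| ≤ sb)
        (hNχ : ∀ y : Site (PV d ℓ m K hd hL) 0, blkS hN D y ∉ N →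
          (∀ μ, χ (y.shift μ) = χ y ∧ χ (y.unshift μ) = χ y) ∧ ∀ x, blkS hN D x = blkS hN D y → χ x = χ y)
        (hcL : ∀ x, cL x * χ x = cL x) (ζ h : PBond (PV d ℓ m K hd hL) 0 → ℝ)
        (hζ1 : ∀ b, |ζ b| ≤ 1) (hζd : ∀ b, ζ b ≠ 0 → b.src ∈ DeepS t x₀ 1) (hh1 : ∀ b, |h b| ≤ 1) (hhd : ∀ b, h b ≠ 0 → b.src ∈ DeepS t x₀ 1)
        (hEL : (mulOp ζ ∘ₗ onFun (dE (P := PV d ℓ m K hd hL) cf)) ∘ₗ mulOp cL = mulOp ζ ∘ₗ onFun (dE (P := PV d ℓ m K hd hL) cf))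
        {M₀ : ℝ} (hζdeep : ∀ v, ζ v ≠ 0 → ∀ n ∈ N, M₀ ≤ (geomW hN D hx₀ hfit hN₁ D₁).dist (blkV1 hN D v) n)
        (hhdeep : ∀ v, h v ≠ 0 → ∀ n ∈ N, M₀ ≤ (geomW hN D hx₀ hfit hN₁ D₁).dist (blkV1 hN D v) n),
        HasMajorant (g := geomW hN D hx₀ hfit hN₁ D₁) (blkV1 hN D)
          (mulOp ζ * ((onFun (dE (P := PV d ℓ m K hd hL) cf) ∘ₗ
              (GpV hN D cf * SV hN D cf * GpV hN D cf -
                transplant (cS t x₀ hx₀ hfit).W (eS t x₀) (GpV hN₁ D₁ cf) * transplant (cS t x₀ hx₀ hfit).W (eS t x₀) (SV hN₁ D₁ cf) *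
                  transplant (cS t x₀ hx₀ hfit).W (eS t x₀) (GpV hN₁ D₁ cf))) ∘ₗ
              onFun (dsE (P := PV d ℓ m K hd hL) cf)) * mulOp h)
          (fun a b => CDgk (((ℓ : ℝ) + 1) ^ (2 + (k₁ - jlo))) C C (((d : ℝ) + 1) * C)
              (((d : ℝ) + 1) * (s₁ * C * (1 + Real.exp δ) + s₂ * C) + sb * C)
              ((((Finset.univ : Finset (Fin (d + 1) × Bool)).card : ℝ) *
                  ((((ℓ : ℝ) + 1) ^ (2 + (k₁ - jlo))) * (|cf| * s₁) *
                      (Real.exp (1 + δ) * Kp 1 * |cf|⁻¹ * (((d : ℝ) + 1) * |cf|⁻¹ * C) * |cf|) +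
                    (((ℓ : ℝ) + 1) ^ (2 + (k₁ - jlo))) ^ 2 * 0 * C) +
                (((ℓ : ℝ) + 1) ^ (2 + (k₁ - jlo))) ^ 2 * (((d : ℝ) + 1) * s₂ + sb) * C) / 1)
              (Kp ((δ - 2 * κ) / 192) * (1 + (Fintype.card ↥(bset D₁.toDomains) : ℝ))) *
            Real.exp (-((δ - 2 * κ) / 96 * M₀)) / ((geomW hN D hx₀ hfit hN₁ D₁).len a / |cf|) ^ 2 *
            Real.exp (-((δ - 2 * κ) / 192 * (geomW hN D hx₀ hfit hN₁ D₁).dist a b))) := by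
  obtain ⟨M₁, δ, C, hM₁, hδ, hC, hfac⟩ := factors_V1_TB d ℓ hd hL
  refine ⟨M₁, δ, C, hM₁, hδ, hC, ?_⟩
  intro m K Mh k R P' hN D hk a₀ a₁ t x₀ hx₀ hfit Mh₁ k₁ R₁ P₁ hN₁ D₁ hlevW hal hk₁ jlo hlo hjlo hP4 hR hM hMh₁ hP₁ hR₁ hM' hRM κ hκ hκRM hκδ
    Kp hPrT hKp0 hKanti cf hcf χ cL N hNne hχ0 hχ1 hχN hχ3 hχjump s₁ s₂ sb hs₁ hs₂ hsb hd1 hd1' hd2 hdb hNχ hcL ζ h hζ1 hζd hh1 hhd hEL M₀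
    hζdeep hhdeep
  letI instW : DecidableEq (geomW hN D hx₀ hfit hN₁ D₁).Site := inferInstanceAs (DecidableEq ↥(bset D.toDomains))
  -- ### (0) scalars
  have hℓ : 1 ≤ ℓ := by have := hL.2; omega
  have hP1 : ∀ μ, 1 ≤ P' μ := fun μ => le_trans (by norm_num) (hP4 μ)
  have hP₁1 : ∀ μ, 1 ≤ P₁ μ := fun μ => le_trans (by norm_num) (hP₁ μ)
  have hMh1 : 1 ≤ Mh := by
    by_contra h0
    have : Mh = 0 := by omega
    rw [this, Nat.cast_zero, mul_zero] at hM
    linarith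
  have hcfabs : 0 < |cf| := abs_pos.2 hcf
  have habs0 : |cf| ≠ 0 := hcfabs.ne'
  have hδ' : 0 < δ - 2 * κ := by linarith
  have hδ'le : δ - 2 * κ ≤ δ := by linarith
  have hκδ' : 6 * κ ≤ δ - 2 * κ := by linarith
  have hd0 : ∀ a b : ↥(bset D.toDomains), 0 ≤ (geomW hN D hx₀ hfit hN₁ D₁).dist a b := distW_nonneg hN D hx₀ hfit hN₁ D₁
  have hlenW : ∀ a : ↥(bset D.toDomains), (geomW hN D hx₀ hfit hN₁ D₁).len a = ((ℓ : ℝ) + 1) ^ a.1.1 * 1 := fun a => rfl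
  have hlen0 : ∀ a : ↥(bset D.toDomains), 0 < (geomW hN D hx₀ hfit hN₁ D₁).len a := fun a => by rw [hlenW]; positivity
  have hw : ∀ a : ↥(bset D.toDomains), 0 < (geomW hN D hx₀ hfit hN₁ D₁).len a / |cf| := fun a => div_pos (hlen0 a) hcfabs
  have hρ : IsPseudoDist (geomW hN D hx₀ hfit hN₁ D₁).dist := isPseudoDist_W hN D hx₀ hfit hN₁ D₁ hMh1 hP1
  have hK1 : 0 ≤ Kp 1 := hKp0 1 one_pos
  -- ### (1) the factor majorants on `d_T`, both carriers, ONE constant triple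
  obtain ⟨g1, g2, g3, g4⟩ := hfac m K hN D hP4 hR hM hcf
  obtain ⟨m1, m2, m3, m4⟩ := hfac t.m t.K hN₁ D₁ hP₁ hR₁ hM' hcf
  -- ### (2) lifted to the glued geometry
  have G1 := hasMajorant_glob_W' hN D hx₀ hfit hN₁ D₁ hMh1 hP1 (φ := fun y => (cf ^ 2)⁻¹ * C * (geomTB D).len y ^ 2)
    (fun y => by rw [geomTB_len]; positivity) hδ.le g1
  have G2 : ∀ ζ' : PBond (PV d ℓ m K hd hL) 0 → ℝ, (∀ b, |ζ' b| ≤ 1) →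
      HasMajorantHom (g := geomW hN D hx₀ hfit hN₁ D₁) (blkS hN D) (blkV1 hN D)
        ((mulOp ζ' ∘ₗ onFun (dE (P := PV d ℓ m K hd hL) cf)) ∘ₗ GpV hN D cf)
        (fun y y' => |cf|⁻¹ * C * (geomTB D).len y * Real.exp (-(δ * (geomW hN D hx₀ hfit hN₁ D₁).dist y y'))) := by
    intro ζ' hζ'
    rw [LinearMap.comp_assoc]
    exact hasMajorantHom_mulOp_left (g := geomW hN D hx₀ hfit hN₁ D₁) (blkS hN D) (blkV1 hN D)
      (hasMajorantHom_glob_W_SY hN D hx₀ hfit hN₁ D₁ hMh1 hP1 (φ := fun y => |cf|⁻¹ * C * (geomTB D).len y)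
        (fun y => by rw [geomTB_len]; positivity) hδ.le g2) ζ' hζ'
  have G3' := hasMajorantHom_glob_W_YS hN D hx₀ hfit hN₁ D₁ hMh1 hP1 (φ := fun y => ((d : ℝ) + 1) * |cf|⁻¹ * C * (geomTB D).len y)
    (fun y => by rw [geomTB_len]; positivity) hδ.le g3
  have G3 : HasMajorantHom (g := geomW hN D hx₀ hfit hN₁ D₁) (blkV1 hN D) (blkS hN D)
      (GpV hN D cf ∘ₗ (onFun (dsE (P := PV d ℓ m K hd hL) cf) ∘ₗ mulOp h))
      (fun y y' => ((d : ℝ) + 1) * |cf|⁻¹ * C * (geomTB D).len y * Real.exp (-(δ * (geomW hN D hx₀ hfit hN₁ D₁).dist y y'))) := by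
    rw [← LinearMap.comp_assoc]
    exact hasMajorantHom_mulOp_right (g := geomW hN D hx₀ hfit hN₁ D₁) (blkV1 hN D) (blkS hN D) G3' h hh1
  have G4 := hasMajorant_glob_W' hN D hx₀ hfit hN₁ D₁ hMh1 hP1 (φ := fun y => cf ^ 4 * C * ((geomTB D).len y ^ 4)⁻¹)
    (fun y => by rw [geomTB_len]; positivity) hδ.le g4
  have W1 := hasMajorant_member_W hN D hx₀ hfit hN₁ D₁ hlevW hal hMh₁ hP₁1
    (φ := fun j => (cf ^ 2)⁻¹ * C * (((ℓ : ℝ) + 1) ^ j * 1) ^ 2) (fun j => by positivity) hδ.le m1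
  have W2 : ∀ ζ' : PBond (PV d ℓ m K hd hL) 0 → ℝ, (∀ b, |ζ' b| ≤ 1) → (∀ b, ζ' b ≠ 0 → b.src ∈ DeepS t x₀ 1) →
      HasMajorantHom (g := geomW hN D hx₀ hfit hN₁ D₁) (blkS hN D) (blkV1 hN D)
        ((mulOp ζ' ∘ₗ onFun (dE (P := PV d ℓ m K hd hL) cf)) ∘ₗ transplant (cS t x₀ hx₀ hfit).W (eS t x₀) (GpV hN₁ D₁ cf))
        (fun y y' => |cf|⁻¹ * C * (((ℓ : ℝ) + 1) ^ y.1.1 * 1) * Real.exp (-(δ * (geomW hN D hx₀ hfit hN₁ D₁).dist y y'))) :=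
    fun ζ' hζ'1 hζ'd => hasMajorantHom_cutLeft_W hN D hx₀ hfit hN₁ D₁ hlevW hal hMh₁ hP₁1
      (φ := fun j => |cf|⁻¹ * C * (((ℓ : ℝ) + 1) ^ j * 1)) (fun j => by positivity) hδ.le m2 ζ' hζ'1 hζ'd
  have W3 := hasMajorantHom_cutRight_W hN D hx₀ hfit hN₁ D₁ hlevW hal hMh₁ hP₁1
    (φ := fun j => ((d : ℝ) + 1) * |cf|⁻¹ * C * (((ℓ : ℝ) + 1) ^ j * 1)) (fun j => by positivity) hδ.le m3 h hh1 hhd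
  have W4 := hasMajorant_member_W hN D hx₀ hfit hN₁ D₁ hlevW hal hMh₁ hP₁1
    (φ := fun j => cf ^ 4 * C * ((((ℓ : ℝ) + 1) ^ j * 1) ^ 4)⁻¹) (fun j => by positivity) hδ.le m4
  -- ### (3) the auxiliary bond indicator of margin 1 (the `ζ` of the zone-kernel legs)
  let ζ1 : PBond (PV d ℓ m K hd hL) 0 → ℝ := Set.indicator (DeepB t x₀ 1) (fun _ => (1 : ℝ))
  have hζ1_1 : ∀ b, |ζ1 b| ≤ 1 := fun b => by
    by_cases hb : b ∈ DeepB t x₀ 1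
    · simp only [ζ1, Set.indicator_of_mem hb, abs_one, le_refl]
    · simp only [ζ1, Set.indicator_of_notMem hb, abs_zero, zero_le_one]
  have hζ1_d : ∀ b, ζ1 b ≠ 0 → b.src ∈ DeepS t x₀ 1 := fun b hb => by
    by_contra hn
    exact hb (Set.indicator_of_notMem (show b ∉ DeepB t x₀ 1 from hn) _)
  have hζ1_χ : ∀ b : PBond (PV d ℓ m K hd hL) 0, χ b.tgt ≠ χ b.src → ζ1 b = 1 := fun b hb =>
    Set.indicator_of_mem (show b ∈ DeepB t x₀ 1 from hχjump b hb) _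
  -- ### (4) reshaping to p38's weight `w = len/|c_f|` and rate `δ′ = δ − 2κ`
  have eG : ∀ a : ↥(bset D.toDomains), (cf ^ 2)⁻¹ * C * (geomTB D).len a ^ 2 = C * ((geomW hN D hx₀ hfit hN₁ D₁).len a / |cf|) ^ 2 :=
    fun a => by rw [geomW_len]; exact k_sq hcf C _
  have eGm : ∀ a : ↥(bset D.toDomains), (cf ^ 2)⁻¹ * C * (((ℓ : ℝ) + 1) ^ a.1.1 * 1) ^ 2 =
      C * ((geomW hN D hx₀ hfit hN₁ D₁).len a / |cf|) ^ 2 := fun a => by rw [hlenW]; exact k_sq hcf C _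
  have eE : ∀ a : ↥(bset D.toDomains), |cf|⁻¹ * C * (geomTB D).len a = C * ((geomW hN D hx₀ hfit hN₁ D₁).len a / |cf|) :=
    fun a => by rw [geomW_len]; exact k_one C _
  have eEm : ∀ a : ↥(bset D.toDomains), |cf|⁻¹ * C * (((ℓ : ℝ) + 1) ^ a.1.1 * 1) = C * ((geomW hN D hx₀ hfit hN₁ D₁).len a / |cf|) :=
    fun a => by rw [hlenW]; exact k_one C _
  have eE' : ∀ a : ↥(bset D.toDomains), ((d : ℝ) + 1) * |cf|⁻¹ * C * (geomTB D).len a =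
      (((d : ℝ) + 1) * C) * ((geomW hN D hx₀ hfit hN₁ D₁).len a / |cf|) :=
    fun a => by rw [geomW_len, mul_assoc, mul_assoc, ← mul_assoc |cf|⁻¹, k_one C _, ← mul_assoc]
  have eE'm : ∀ a : ↥(bset D.toDomains), ((d : ℝ) + 1) * |cf|⁻¹ * C * (((ℓ : ℝ) + 1) ^ a.1.1 * 1) =
      (((d : ℝ) + 1) * C) * ((geomW hN D hx₀ hfit hN₁ D₁).len a / |cf|) :=
    fun a => by rw [hlenW, mul_assoc, mul_assoc, ← mul_assoc |cf|⁻¹, k_one C _, ← mul_assoc]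
  have eS4 : ∀ a : ↥(bset D.toDomains), cf ^ 4 * C * ((geomTB D).len a ^ 4)⁻¹ = C * (((geomW hN D hx₀ hfit hN₁ D₁).len a / |cf|) ^ 4)⁻¹ :=
    fun a => by rw [geomW_len]; exact k_four hcf C (by rw [← geomW_len hN D hx₀ hfit hN₁ D₁]; exact (hlen0 a).ne')
  have eS4m : ∀ a : ↥(bset D.toDomains), cf ^ 4 * C * ((((ℓ : ℝ) + 1) ^ a.1.1 * 1) ^ 4)⁻¹ =
      C * (((geomW hN D hx₀ hfit hN₁ D₁).len a / |cf|) ^ 4)⁻¹ :=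
    fun a => by rw [hlenW]; exact k_four hcf C (by rw [← hlenW]; exact (hlen0 a).ne')
  have hexp : ∀ a b : ↥(bset D.toDomains), Real.exp (-(δ * (geomW hN D hx₀ hfit hN₁ D₁).dist a b)) ≤
      Real.exp (-((δ - 2 * κ) * (geomW hN D hx₀ hfit hN₁ D₁).dist a b)) := fun a b => exp_rate_mono hδ'le (hd0 a b)
  have hCd : C ≤ ((d : ℝ) + 1) * C := by
    have : (1 : ℝ) ≤ (d : ℝ) + 1 := by have := Nat.cast_nonneg (α := ℝ) d; linarith
    nlinarith
  -- the eight leg/diagonal kernels in p38's shape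
  have mG : HasMajorant (g := geomW hN D hx₀ hfit hN₁ D₁) (blkS hN D) (GpV hN D cf)
      (fun a b => C * ((geomW hN D hx₀ hfit hN₁ D₁).len a / |cf|) ^ 2 * Real.exp (-((δ - 2 * κ) * (geomW hN D hx₀ hfit hN₁ D₁).dist a b))) :=
    hasMajorant_mono _ G1 fun a b => by
      rw [eG]; exact mul_le_mul_of_nonneg_left (hexp a b) (by have := hw a; positivity)
  have mG0 : HasMajorant (g := geomW hN D hx₀ hfit hN₁ D₁) (blkS hN D) (GpV hN D cf)
      (fun a b => C * ((geomW hN D hx₀ hfit hN₁ D₁).len a / |cf|) ^ 2 * Real.exp (-(δ * (geomW hN D hx₀ hfit hN₁ D₁).dist a b))) :=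
    hasMajorant_mono _ G1 fun a b => by rw [eG]
  have mGw : HasMajorant (g := geomW hN D hx₀ hfit hN₁ D₁) (blkS hN D) (transplant (cS t x₀ hx₀ hfit).W (eS t x₀) (GpV hN₁ D₁ cf))
      (fun a b => C * ((geomW hN D hx₀ hfit hN₁ D₁).len a / |cf|) ^ 2 * Real.exp (-((δ - 2 * κ) * (geomW hN D hx₀ hfit hN₁ D₁).dist a b))) :=
    hasMajorant_mono _ W1 fun a b => by
      rw [eGm]; exact mul_le_mul_of_nonneg_left (hexp a b) (by have := hw a; positivity)
  have mS : HasMajorant (g := geomW hN D hx₀ hfit hN₁ D₁) (blkS hN D) (SV hN D cf)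
      (fun a b => C * (((geomW hN D hx₀ hfit hN₁ D₁).len a / |cf|) ^ 4)⁻¹ * Real.exp (-((δ - 2 * κ) * (geomW hN D hx₀ hfit hN₁ D₁).dist a b))) :=
    hasMajorant_mono _ G4 fun a b => by
      rw [eS4]; exact mul_le_mul_of_nonneg_left (hexp a b) (by have := hw a; positivity)
  have mSw : HasMajorant (g := geomW hN D hx₀ hfit hN₁ D₁) (blkS hN D) (transplant (cS t x₀ hx₀ hfit).W (eS t x₀) (SV hN₁ D₁ cf))
      (fun a b => C * (((geomW hN D hx₀ hfit hN₁ D₁).len a / |cf|) ^ 4)⁻¹ * Real.exp (-((δ - 2 * κ) * (geomW hN D hx₀ hfit hN₁ D₁).dist a b))) :=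
    hasMajorant_mono _ W4 fun a b => by
      rw [eS4m]; exact mul_le_mul_of_nonneg_left (hexp a b) (by have := hw a; positivity)
  have mEG' : HasMajorantHom (g := geomW hN D hx₀ hfit hN₁ D₁) (blkS hN D) (blkV1 hN D)
      ((mulOp ζ ∘ₗ onFun (dE (P := PV d ℓ m K hd hL) cf)) ∘ₗ GpV hN D cf)
      (fun a b => ((d : ℝ) + 1) * C * ((geomW hN D hx₀ hfit hN₁ D₁).len a / |cf|) *
        Real.exp (-((δ - 2 * κ) * (geomW hN D hx₀ hfit hN₁ D₁).dist a b))) :=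
    hasMajorantHom_mono _ _ (G2 ζ hζ1) fun a b => by
      rw [eE]
      exact mul_le_mul (mul_le_mul_of_nonneg_right hCd (hw a).le) (hexp a b) (Real.exp_pos _).le (by have := hw a; positivity)
  have mEGw' : HasMajorantHom (g := geomW hN D hx₀ hfit hN₁ D₁) (blkS hN D) (blkV1 hN D)
      ((mulOp ζ ∘ₗ onFun (dE (P := PV d ℓ m K hd hL) cf)) ∘ₗ transplant (cS t x₀ hx₀ hfit).W (eS t x₀) (GpV hN₁ D₁ cf))
      (fun a b => ((d : ℝ) + 1) * C * ((geomW hN D hx₀ hfit hN₁ D₁).len a / |cf|) *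
        Real.exp (-((δ - 2 * κ) * (geomW hN D hx₀ hfit hN₁ D₁).dist a b))) :=
    hasMajorantHom_mono _ _ (W2 ζ hζ1 hζd) fun a b => by
      rw [eEm]
      exact mul_le_mul (mul_le_mul_of_nonneg_right hCd (hw a).le) (hexp a b) (Real.exp_pos _).le (by have := hw a; positivity)
  have mGE' : HasMajorantHom (g := geomW hN D hx₀ hfit hN₁ D₁) (blkV1 hN D) (blkS hN D)
      (GpV hN D cf ∘ₗ (onFun (dsE (P := PV d ℓ m K hd hL) cf) ∘ₗ mulOp h))
      (fun a b => ((d : ℝ) + 1) * C * ((geomW hN D hx₀ hfit hN₁ D₁).len a / |cf|) *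
        Real.exp (-((δ - 2 * κ) * (geomW hN D hx₀ hfit hN₁ D₁).dist a b))) :=
    hasMajorantHom_mono _ _ G3 fun a b => by
      rw [eE']; exact mul_le_mul_of_nonneg_left (hexp a b) (by have := hw a; positivity)
  have mGwE' : HasMajorantHom (g := geomW hN D hx₀ hfit hN₁ D₁) (blkV1 hN D) (blkS hN D)
      (transplant (cS t x₀ hx₀ hfit).W (eS t x₀) (GpV hN₁ D₁ cf) ∘ₗ (onFun (dsE (P := PV d ℓ m K hd hL) cf) ∘ₗ mulOp h))
      (fun a b => ((d : ℝ) + 1) * C * ((geomW hN D hx₀ hfit hN₁ D₁).len a / |cf|) *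
        Real.exp (-((δ - 2 * κ) * (geomW hN D hx₀ hfit hN₁ D₁).dist a b))) :=
    hasMajorantHom_mono _ _ W3 fun a b => by
      rw [eE'm]; exact mul_le_mul_of_nonneg_left (hexp a b) (by have := hw a; positivity)
  -- ### (5) the ring data across the window
  obtain ⟨rGD, rDG, rχ, -, rS1, rS2, -⟩ := B6ScalarAgreeV1Chart.ringData_window hN D hx₀ hfit hN₁ D₁ hlevW hal hk₁ hℓ hMh1 hP1 hMh₁ hP₁1 hcf χ hχ3
  -- ### (6) the row-zone kernels of `[χ,Δ′]G′`, `[χ,Δ′]G̃′_□`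
  have hθ0 : 0 ≤ ((d : ℝ) + 1) * (s₁ * C * (1 + Real.exp δ) + s₂ * C) + sb * C := by positivity
  have zT : ∀ (T : Module.End ℝ (Site (PV d ℓ m K hd hL) 0 → ℝ)),
      HasMajorant (g := geomW hN D hx₀ hfit hN₁ D₁) (blkS hN D) T
        (fun a b => C * (cf ^ 2)⁻¹ * (geomW hN D hx₀ hfit hN₁ D₁).len a ^ 2 * Real.exp (-(δ * (geomW hN D hx₀ hfit hN₁ D₁).dist a b))) →
      HasMajorantHom (g := geomW hN D hx₀ hfit hN₁ D₁) (blkS hN D) (blkV1 hN D)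
        ((mulOp ζ1 ∘ₗ onFun (dE (P := PV d ℓ m K hd hL) cf)) ∘ₗ T)
        (fun a b => C * |cf|⁻¹ * (geomW hN D hx₀ hfit hN₁ D₁).len a * Real.exp (-(δ * (geomW hN D hx₀ hfit hN₁ D₁).dist a b))) →
      HasMajorant (g := geomW hN D hx₀ hfit hN₁ D₁) (blkS hN D) ((mulOp χ * DpV hN D cf - DpV hN D cf * mulOp χ) * T)
        (fun a b => (if a ∈ N then ((d : ℝ) + 1) * (s₁ * C * (1 + Real.exp δ) + s₂ * C) + sb * C else 0) *
          Real.exp (-((δ - 2 * κ) * (geomW hN D hx₀ hfit hN₁ D₁).dist a b))) := by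
    intro T mT mET
    refine hasMajorant_mono _ (zoneKernel_W hN D hx₀ hfit hN₁ D₁ hℓ hMh1 hP1 hcf χ N hs₁ hs₂ hsb hd1 hd2 hdb hNχ ζ1 hζ1_χ T hC.le hC.le
      hδ.le mT mET) fun a b => ?_
    refine mul_le_mul_of_nonneg_left (hexp a b) ?_
    split_ifs
    · exact hθ0
    · exact le_rfl
  have mKG := zT (GpV hN D cf) (hasMajorant_mono _ G1 fun a b => by rw [geomW_len]; ring_nf; exact le_rfl)
    (hasMajorantHom_mono _ _ (G2 ζ1 hζ1_1) fun a b => by rw [geomW_len]; ring_nf; exact le_rfl)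
  have mKGw := zT (transplant (cS t x₀ hx₀ hfit).W (eS t x₀) (GpV hN₁ D₁ cf))
    (hasMajorant_mono _ W1 fun a b => by rw [hlenW]; ring_nf; exact le_rfl)
    (hasMajorantHom_mono _ _ (W2 ζ1 hζ1_1 hζ1_d) fun a b => by rw [hlenW]; ring_nf; exact le_rfl)
  -- ### (7) the transfer (2.60) on the glued geometry and the profile
  have hT : ∀ a c : ↥(bset D.toDomains), Real.exp (-(κ * (geomW hN D hx₀ hfit hN₁ D₁).dist a c)) *
      ((geomW hN D hx₀ hfit hN₁ D₁).len c / |cf|) ≤ ((ℓ : ℝ) + 1) ^ (2 + (k₁ - jlo)) * ((geomW hN D hx₀ hfit hN₁ D₁).len a / |cf|) := by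
    intro a c
    have h0 := transferW hN D hx₀ hfit hN₁ D₁ hlevW hlo hjlo hMh1 hP1 hRM hκ hκRM (w₀ := |cf|⁻¹) (by positivity) a c
    rw [hlenW, hlenW]
    have e1 : ((ℓ : ℝ) + 1) ^ c.1.1 * 1 / |cf| = ((ℓ : ℝ) + 1) ^ c.1.1 * |cf|⁻¹ := by rw [mul_one, div_eq_mul_inv]
    have e2 : ((ℓ : ℝ) + 1) ^ a.1.1 * 1 / |cf| = ((ℓ : ℝ) + 1) ^ a.1.1 * |cf|⁻¹ := by rw [mul_one, div_eq_mul_inv]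
    rw [e1, e2]; exact h0
  have hPrW := profileW hN D hx₀ hfit hN₁ D₁ hMh1 hP1 hPrT
  have hK : ∀ a : ℝ, 0 < a → 0 ≤ Kp a * (1 + (Fintype.card ↥(bset D₁.toDomains) : ℝ)) := fun a ha => by
    have := hKp0 a ha; positivity
  have hKx : ∀ a : ℝ, (δ - 2 * κ) / 192 ≤ a → Kp a * (1 + (Fintype.card ↥(bset D₁.toDomains) : ℝ)) ≤
      Kp ((δ - 2 * κ) / 192) * (1 + (Fintype.card ↥(bset D₁.toDomains) : ℝ)) := fun a ha =>
    mul_le_mul_of_nonneg_right (hKanti _ _ (by positivity) ha) (by positivity)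
  -- ### (8) the column-zone kernel of `G′[χ,Δ′]` by parts (p38's `commZone_right_bd`)
  have hbp : B9Thm37Sum.mulOp χ * DpV hN D cf - DpV hN D cf * B9Thm37Sum.mulOp χ =
      (∑ e ∈ (Finset.univ : Finset (Fin (d + 1) × Bool)), (Fsh e * B9Thm37Sum.mulOp (csχ cf χ e) + B9Thm37Sum.mulOp (fun _ => (0 : ℝ)))) +
        (mulOp (vχ cf χ) + Vavg hN D cf χ) := by
    simp only [mulOp9_eq]
    rw [Kop_byParts', add_assoc]
  have hcs : ∀ e ∈ (Finset.univ : Finset (Fin (d + 1) × Bool)), ∀ x : Site (PV d ℓ m K hd hL) 0,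
      |csχ cf χ e x| ≤ |cf| * s₁ / (1 * ((geomW hN D hx₀ hfit hN₁ D₁).len (blkS hN D x) / |cf|)) := by
    intro e _ x
    have hl := hlen0 (blkS hN D x)
    rw [abs_csχ, one_mul]
    have h1 := hd1' e x
    rw [← geomW_len hN D hx₀ hfit hN₁ D₁] at h1
    have h2 : |χ x - χ (shInv e x)| ≤ s₁ / (geomW hN D hx₀ hfit hN₁ D₁).len (blkS hN D x) := by
      rw [le_div_iff₀ hl]; exact h1
    calc cf ^ 2 * |χ x - χ (shInv e x)| ≤ cf ^ 2 * (s₁ / (geomW hN D hx₀ hfit hN₁ D₁).len (blkS hN D x)) :=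
          mul_le_mul_of_nonneg_left h2 (sq_nonneg _)
      _ = |cf| * s₁ / ((geomW hN D hx₀ hfit hN₁ D₁).len (blkS hN D x) / |cf|) := by
          rw [← sq_abs]; field_simp
  have hcsN : ∀ e ∈ (Finset.univ : Finset (Fin (d + 1) × Bool)), ∀ x : Site (PV d ℓ m K hd hL) 0, csχ cf χ e x ≠ 0 → blkS hN D x ∈ N := by
    intro e _ x hx
    by_contra hn
    apply hx
    obtain ⟨μ, b⟩ := e
    have hc := (hNχ x hn).1 μ
    show cf ^ 2 * (χ x - χ (shInv (μ, b) x)) = 0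
    cases b
    · rw [shInv_ff, hc.1, sub_self, mul_zero]
    · rw [shInv_tt, hc.2, sub_self, mul_zero]
  have hds : ∀ e ∈ (Finset.univ : Finset (Fin (d + 1) × Bool)), ∀ x : Site (PV d ℓ m K hd hL) 0,
      |(fun (_ : Fin (d + 1) × Bool) (_ : Site (PV d ℓ m K hd hL) 0) => (0 : ℝ)) e x| ≤
        0 / (1 * ((geomW hN D hx₀ hfit hN₁ D₁).len (blkS hN D x) / |cf|) ^ 2) := fun e _ x => by simp
  have hdsN : ∀ e ∈ (Finset.univ : Finset (Fin (d + 1) × Bool)), ∀ x : Site (PV d ℓ m K hd hL) 0,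
      (fun (_ : Fin (d + 1) × Bool) (_ : Site (PV d ℓ m K hd hL) 0) => (0 : ℝ)) e x ≠ 0 → blkS hN D x ∈ N := fun e _ x h0 => absurd rfl h0
  -- the diagonal `V = v + V_avg`
  have hv1 : HasMajorant (g := geomW hN D hx₀ hfit hN₁ D₁) (blkS hN D) (mulOp (vχ cf χ))
      (fun a b => if a = b then (if a ∈ N then cf ^ 2 * (((d : ℝ) + 1) * s₂) * ((geomW hN D hx₀ hfit hN₁ D₁).len a ^ 2)⁻¹ else 0) else 0) := by
    refine hasMajorant_mulOp_diag (g := geomW hN D hx₀ hfit hN₁ D₁) (blkS hN D) fun x => ?_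
    split_ifs with hx
    · have hl := hlen0 (blkS hN D x)
      refine (abs_vχ_le cf χ x).trans ?_
      rw [mul_assoc]
      refine mul_le_mul_of_nonneg_left ?_ (sq_nonneg _)
      have hterm : ∀ μ : Fin (d + 1), |χ (x.shift μ) - 2 * χ x + χ (x.unshift μ)| ≤ s₂ * ((geomW hN D hx₀ hfit hN₁ D₁).len (blkS hN D x) ^ 2)⁻¹ := by
        intro μ
        have h2 := hd2 x μ
        rw [← geomW_len hN D hx₀ hfit hN₁ D₁] at h2
        rw [← div_eq_mul_inv, le_div_iff₀ (by positivity)]; exact h2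
      calc ∑ μ : Fin (d + 1), |χ (x.shift μ) - 2 * χ x + χ (x.unshift μ)|
          ≤ ∑ _μ : Fin (d + 1), s₂ * ((geomW hN D hx₀ hfit hN₁ D₁).len (blkS hN D x) ^ 2)⁻¹ := Finset.sum_le_sum fun μ _ => hterm μ
        _ = ((d : ℝ) + 1) * s₂ * ((geomW hN D hx₀ hfit hN₁ D₁).len (blkS hN D x) ^ 2)⁻¹ := by
          rw [Finset.sum_const, Finset.card_univ, Fintype.card_fin, nsmul_eq_mul]; push_cast; ring
    · have h0 : ∀ μ : Fin (d + 1), χ (x.shift μ) - 2 * χ x + χ (x.unshift μ) = 0 := fun μ => by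
        rw [((hNχ x hx).1 μ).1, ((hNχ x hx).1 μ).2]; ring
      rw [vχ]; simp [h0]
  have hv2T := hasMajorant_Vavg hN D hℓ cf χ N hsb hdb (fun y hy => (hNχ y hy).2)
  have hv2 : HasMajorant (g := geomW hN D hx₀ hfit hN₁ D₁) (blkS hN D) (Vavg hN D cf χ)
      (fun a b => if a = b then (if a ∈ N then cf ^ 2 * sb * ((geomTB D).len a ^ 2)⁻¹ else 0) else 0) :=
    fun y' μ B hμ y => hv2T y' μ B ⟨hμ.nonneg, hμ.bound, hμ.off⟩ y
  have hVle : ∀ a b : ↥(bset D.toDomains),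
      ((if a = b then (if a ∈ N then cf ^ 2 * (((d : ℝ) + 1) * s₂) * ((geomW hN D hx₀ hfit hN₁ D₁).len a ^ 2)⁻¹ else 0) else 0) +
        (if a = b then (if a ∈ N then cf ^ 2 * sb * ((geomTB D).len a ^ 2)⁻¹ else 0) else 0) : ℝ) =
      (if a = b then (if a ∈ N then (((d : ℝ) + 1) * s₂ + sb) / (1 * ((geomW hN D hx₀ hfit hN₁ D₁).len a / |cf|) ^ 2) else 0) else 0) := by
    intro a b
    rw [← geomW_len hN D hx₀ hfit hN₁ D₁]
    have hl := hlen0 a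
    split_ifs
    · rw [one_mul, div_pow, sq_abs]
      field_simp
    · simp
    · simp
  -- `G′(S_e − 1)` (mGF) from the `G′∂*` leg and the torus profile
  have mGF : ∀ e ∈ (Finset.univ : Finset (Fin (d + 1) × Bool)),
      HasMajorant (g := geomW hN D hx₀ hfit hN₁ D₁) (blkS hN D) (GpV hN D cf * Fsh e)
        (fun a b => (Real.exp (1 + δ) * Kp 1 * |cf|⁻¹ * (((d : ℝ) + 1) * |cf|⁻¹ * C) * |cf|) *
          ((geomW hN D hx₀ hfit hN₁ D₁).len a / |cf|) * Real.exp (-(δ * (geomW hN D hx₀ hfit hN₁ D₁).dist a b))) := by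
    intro e _
    have h0 := hasMajorant_mul_Fsh_W hN D hx₀ hfit hN₁ D₁ hMh1 hP1 hcf hPrT (GpV hN D cf) (C₃ := ((d : ℝ) + 1) * |cf|⁻¹ * C)
      (by positivity) hδ.le (hasMajorantHom_mono _ _ G3' fun a b => by rw [geomW_len]) e
    refine hasMajorant_mono _ h0 fun a b => le_of_eq ?_
    field_simp
  -- p38's column-zone kernel
  have mGK := commZone_right_bd (g := geomW hN D hx₀ hfit hN₁ D₁) (blkS hN D) hρ (D := DpV hN D cf) (G := GpV hN D cf) (χ := χ)
    (DE := (Finset.univ : Finset (Fin (d + 1) × Bool))) (F := Fsh) (cs := csχ cf χ)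
    (ds := fun (_ : Fin (d + 1) × Bool) (_ : Site (PV d ℓ m K hd hL) 0) => (0 : ℝ)) N
    (w := fun a => (geomW hN D hx₀ hfit hN₁ D₁).len a / |cf|) hw (κ := κ) (Λ := ((ℓ : ℝ) + 1) ^ (2 + (k₁ - jlo))) hκ hT
    (M := 1) (s₁ := |cf| * s₁) (s₂ := 0) (C₁' := Real.exp (1 + δ) * Kp 1 * |cf|⁻¹ * (((d : ℝ) + 1) * |cf|⁻¹ * C) * |cf|) (B₁ := C) (δ := δ)
    one_pos (by positivity) le_rfl (by positivity) hC.le (V := mulOp (vχ cf χ) + Vavg hN D cf χ) (s₃ := ((d : ℝ) + 1) * s₂ + sb)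
    (by positivity) hbp hcs hcsN hds hdsN
    (hasMajorant_mono _ (hasMajorant_add _ hv1 hv2) fun a b => le_of_eq (hVle a b))
    mGF mG0
  -- ### (9) p38's size theorem
  have hθ₂ : 0 ≤ (((Finset.univ : Finset (Fin (d + 1) × Bool)).card : ℝ) *
                  ((((ℓ : ℝ) + 1) ^ (2 + (k₁ - jlo))) * (|cf| * s₁) *
                      (Real.exp (1 + δ) * Kp 1 * |cf|⁻¹ * (((d : ℝ) + 1) * |cf|⁻¹ * C) * |cf|) +
                    (((ℓ : ℝ) + 1) ^ (2 + (k₁ - jlo))) ^ 2 * 0 * C) +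
                (((ℓ : ℝ) + 1) ^ (2 + (k₁ - jlo))) ^ 2 * (((d : ℝ) + 1) * s₂ + sb) * C) / 1 := by
    have hΛ0 : (0 : ℝ) ≤ ((ℓ : ℝ) + 1) ^ (2 + (k₁ - jlo)) := by positivity
    have hC1' : (0 : ℝ) ≤ Real.exp (1 + δ) * Kp 1 * |cf|⁻¹ * (((d : ℝ) + 1) * |cf|⁻¹ * C) * |cf| := by positivity
    refine div_nonneg (add_nonneg (mul_nonneg (Nat.cast_nonneg _) (add_nonneg ?_ ?_)) ?_) zero_le_one
    · exact mul_nonneg (mul_nonneg hΛ0 (by positivity)) hC1'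
    · rw [mul_zero, zero_mul]
    · exact mul_nonneg (mul_nonneg (by positivity) (by positivity)) hC.le
  have key := line3P_hasMajorant_gk_zone_cut (g := geomW hN D hx₀ hfit hN₁ D₁) (blkS hN D) (blkV1 hN D) hρ
    (K := fun a => Kp a * (1 + (Fintype.card ↥(bset D₁.toDomains) : ℝ))) hK hPrW N hNne
    (w := fun a => (geomW hN D hx₀ hfit hN₁ D₁).len a / |cf|) hw (κ := κ) (Λ := ((ℓ : ℝ) + 1) ^ (2 + (k₁ - jlo))) (δ := δ - 2 * κ)
    (Kx := Kp ((δ - 2 * κ) / 192) * (1 + (Fintype.card ↥(bset D₁.toDomains) : ℝ))) (by positivity) hT hδ' hκδ' hKx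
    (G := GpV hN D cf) (D := DpV hN D cf) (Gw := transplant (cS t x₀ hx₀ hfit).W (eS t x₀) (GpV hN₁ D₁ cf)) (S := SV hN D cf)
    (Sw := transplant (cS t x₀ hx₀ hfit).W (eS t x₀) (SV hN₁ D₁ cf)) (χ := χ) (cL := cL)
    (EL₀ := onFun (dE (P := PV d ℓ m K hd hL) cf)) (ER₀ := onFun (dsE (P := PV d ℓ m K hd hL) cf)) (ζ := ζ) (h := h)
    rGD rDG rχ rS1 rS2 hcL hEL hχ0 hχ1 hχN (M₀ := M₀) hζdeep hhdeep
    (B₁ := C) (BS := C) (C₁ := ((d : ℝ) + 1) * C)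
    (θ := ((d : ℝ) + 1) * (s₁ * C * (1 + Real.exp δ) + s₂ * C) + sb * C) hC.le hC.le (by positivity) hθ0 hθ₂
    mG mGw mS mSw mEG' mEGw'
    mGE' mGwE'
    mKG mKGw mGK
  exact key

end Main

/-! ## §3  From the glued distance `d′` to `d_T` on located pairs (rows in `supp ζ`, columns in `supp h`) -/

section Located

variable {Mh k R : ℕ} {P' : Fin (d + 1) → ℕ}
variable (hN : ∀ μ, N0 ℓ Mh k P' μ = (PV d ℓ m K hd hL).sitesPerDir 0) (D : TDomains d ℓ Mh k P' R)
variable {a₀ a₁ : ℝ} {t : TSIdx d (ℓ + 1) hd hL a₀ a₁} {x₀ : Fin (d + 1) → ℤ}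
variable (hx₀ : ∀ μ, 0 ≤ x₀ μ) (hfit : ∀ μ, x₀ μ + (t.P.sitesPerDir 0 : ℕ) ≤ ((PV d ℓ m K hd hL).sitesPerDir 0 : ℕ))
variable {Mh₁ k₁ R₁ : ℕ} {P₁ : Fin (d + 1) → ℕ}
variable (hN₁ : ∀ μ, N0 ℓ Mh₁ k₁ P₁ μ = (PV d ℓ t.m t.K hd hL).sitesPerDir 0) (D₁ : TDomains d ℓ Mh₁ k₁ P₁ R₁)

/-- **CUT-OFF SANDWICHES SEE ONLY LOCATED PAIRS**: a majorant `F(y)·e^{−r·d′(y,y″)}` of `ζ·X·h` on the glued geometry is a majorant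
`F(y)·e^{−r·d_T(y,y″)}` on the torus geometry as soon as `d′ = d_T` between the blocks of `supp ζ` and the blocks of `supp h`
(`B6GluedDistWindow.dist_eq_of_far_faces` supplies this for blocks far from the glued faces). [cite: Balaban1984PropagatorsII, (2.92) p.239 line 3
(«ζ_□ … h_□»), (2.46) p.231; derivation ours] -/
theorem hasMajorant_cut_W_to_T {X : Module.End ℝ (PBond (PV d ℓ m K hd hL) 0 → ℝ)} (ζ h : PBond (PV d ℓ m K hd hL) 0 → ℝ)
    {F : ↥(bset D.toDomains) → ℝ} (hF : ∀ a, 0 ≤ F a) (r : ℝ)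
    (hW : HasMajorant (g := geomW hN D hx₀ hfit hN₁ D₁) (blkV1 hN D) (mulOp ζ * X * mulOp h)
      (fun a b => F a * Real.exp (-(r * (geomW hN D hx₀ hfit hN₁ D₁).dist a b))))
    (hloc : ∀ v, ζ v ≠ 0 → ∀ v', h v' ≠ 0 →
      (geomW hN D hx₀ hfit hN₁ D₁).dist (blkV1 hN D v) (blkV1 hN D v') = (geomTB D).dist (blkV1 hN D v) (blkV1 hN D v')) :
    HasMajorant (g := geomTB D) (blkV1 hN D) (mulOp ζ * X * mulOp h) (fun a b => F a * Real.exp (-(r * (geomTB D).dist a b))) := by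
  intro y' μ B hμ v
  have hB : 0 ≤ B := hμ.nonneg
  have hK0 : 0 ≤ F (blkV1 hN D v) * Real.exp (-(r * (geomTB D).dist (blkV1 hN D v) y')) * B :=
    mul_nonneg (mul_nonneg (hF _) (Real.exp_pos _).le) hB
  by_cases hζ : ζ v = 0
  · rw [Module.End.mul_apply, Module.End.mul_apply, mulOp_apply, hζ, zero_mul, abs_zero]; exact hK0
  -- is the column block `y′` a block of `supp h`?
  by_cases hcol : ∃ v', h v' ≠ 0 ∧ blkV1 hN D v' = y'
  · obtain ⟨v', hv', hv'y⟩ := hcol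
    have h0 := hW y' μ B ⟨hμ.nonneg, hμ.bound, hμ.off⟩ v
    rw [← hv'y] at h0 ⊢
    dsimp only at h0 ⊢
    rw [hloc v hζ v' hv'] at h0
    exact h0
  · -- otherwise `h·μ = 0`, so the whole term vanishes
    have hμ0 : mulOp h μ = 0 := by
      funext x
      rw [mulOp_apply, Pi.zero_apply]
      by_cases hx : blkV1 hN D x = y'
      · by_cases hh : h x = 0
        · rw [hh, zero_mul]
        · exact absurd ⟨x, hh, hx⟩ hcol
      · rw [hμ.off x hx, mul_zero]
    rw [Module.End.mul_apply, Module.End.mul_apply, hμ0, map_zero, map_zero, Pi.zero_apply, abs_zero]; exact hK0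

/-- **THE ROBUST CUT `d′ ↦ d_T` (no equality needed)**: if on located pairs (rows in `supp ζ`, columns in `supp h`) the glued distance dominates
`min(d_T, D₀)` (`B6GluedDistWindow.le_distW_of_far`: a glued geodesic stays in the torus graph or first reaches a face block, at `d_T`-distance
`≥ D₀ − 1` from the located rows) and located pairs are `d_T`-close relative to the face depth, `θ·d_T ≤ D₀` (`θ ≤ 1`), then a majorant
`F(y)·e^{−r·d′(y,y″)}` of `ζ·X·h` on the glued geometry is a majorant `F(y)·e^{−rθ·d_T(y,y″)}` on the torus geometry: in both cases of the `min`,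
`rθ·d_T ≤ r·d′`. [cite: Balaban1984PropagatorsII, (2.92) p.239 line 3 («ζ_□ … h_□»), (2.46) p.231, p.238 (□̃ margins); derivation ours] -/
theorem hasMajorant_cut_W_to_T_of_min {X : Module.End ℝ (PBond (PV d ℓ m K hd hL) 0 → ℝ)} (ζ h : PBond (PV d ℓ m K hd hL) 0 → ℝ)
    {F : ↥(bset D.toDomains) → ℝ} (hF : ∀ a, 0 ≤ F a) {r θ D₀ : ℝ} (hr : 0 ≤ r) (hθ1 : θ ≤ 1)
    (hW : HasMajorant (g := geomW hN D hx₀ hfit hN₁ D₁) (blkV1 hN D) (mulOp ζ * X * mulOp h)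
      (fun a b => F a * Real.exp (-(r * (geomW hN D hx₀ hfit hN₁ D₁).dist a b))))
    (hmin : ∀ v, ζ v ≠ 0 → ∀ v', h v' ≠ 0 →
      min ((geomTB D).dist (blkV1 hN D v) (blkV1 hN D v')) D₀ ≤ (geomW hN D hx₀ hfit hN₁ D₁).dist (blkV1 hN D v) (blkV1 hN D v'))
    (hD₀ : ∀ v, ζ v ≠ 0 → ∀ v', h v' ≠ 0 → θ * (geomTB D).dist (blkV1 hN D v) (blkV1 hN D v') ≤ D₀) :
    HasMajorant (g := geomTB D) (blkV1 hN D) (mulOp ζ * X * mulOp h)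
      (fun a b => F a * Real.exp (-((r * θ) * (geomTB D).dist a b))) := by
  intro y' μ B hμ v
  have hB : 0 ≤ B := hμ.nonneg
  have hK0 : 0 ≤ F (blkV1 hN D v) * Real.exp (-((r * θ) * (geomTB D).dist (blkV1 hN D v) y')) * B :=
    mul_nonneg (mul_nonneg (hF _) (Real.exp_pos _).le) hB
  by_cases hζ : ζ v = 0
  · rw [Module.End.mul_apply, Module.End.mul_apply, mulOp_apply, hζ, zero_mul, abs_zero]; exact hK0
  by_cases hcol : ∃ v', h v' ≠ 0 ∧ blkV1 hN D v' = y'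
  · obtain ⟨v', hv', hv'y⟩ := hcol
    have h0 := hW y' μ B ⟨hμ.nonneg, hμ.bound, hμ.off⟩ v
    rw [← hv'y] at h0 ⊢
    dsimp only at h0 ⊢
    refine h0.trans (mul_le_mul_of_nonneg_right (mul_le_mul_of_nonneg_left (Real.exp_le_exp.2 (neg_le_neg ?_)) (hF _)) hB)
    -- `rθ·d_T ≤ r·d′` from `min(d_T, D₀) ≤ d′` and `θ·d_T ≤ D₀`
    have hm := hmin v hζ v' hv'
    have hθd := hD₀ v hζ v' hv'
    have hdT0 : 0 ≤ (geomTB D).dist (blkV1 hN D v) (blkV1 hN D v') := Nat.cast_nonneg _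
    rcases le_total ((geomTB D).dist (blkV1 hN D v) (blkV1 hN D v')) D₀ with hle | hle
    · rw [min_eq_left hle] at hm
      calc r * θ * (geomTB D).dist (blkV1 hN D v) (blkV1 hN D v') ≤ r * 1 * (geomTB D).dist (blkV1 hN D v) (blkV1 hN D v') := by
            gcongr
        _ ≤ r * (geomW hN D hx₀ hfit hN₁ D₁).dist (blkV1 hN D v) (blkV1 hN D v') := by rw [mul_one]; exact mul_le_mul_of_nonneg_left hm hr
    · rw [min_eq_right hle] at hm
      calc r * θ * (geomTB D).dist (blkV1 hN D v) (blkV1 hN D v') = r * (θ * (geomTB D).dist (blkV1 hN D v) (blkV1 hN D v')) := by ring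
        _ ≤ r * D₀ := mul_le_mul_of_nonneg_left hθd hr
        _ ≤ r * (geomW hN D hx₀ hfit hN₁ D₁).dist (blkV1 hN D v) (blkV1 hN D v') := mul_le_mul_of_nonneg_left hm hr
  · have hμ0 : mulOp h μ = 0 := by
      funext x
      rw [mulOp_apply, Pi.zero_apply]
      by_cases hx : blkV1 hN D x = y'
      · by_cases hh : h x = 0
        · rw [hh, zero_mul]
        · exact absurd ⟨x, hh, hx⟩ hcol
      · rw [hμ.off x hx, mul_zero]
    rw [Module.End.mul_apply, Module.End.mul_apply, hμ0, map_zero, map_zero, Pi.zero_apply, abs_zero]; exact hK0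

/-- **THE `min` HYPOTHESIS FROM THE FACE DEPTH**: if every face block is at `d_T`-distance `≥ D₀ − 1` from the located row block `y`, then
`min(d_T(y,y′), D₀) ≤ d′(y,y′)` (`B6GluedDistWindow.le_distW_of_far` at `r := min(d_T, D₀)`). [cite: Balaban1984PropagatorsII, (2.46) p.231,
p.238 (□̃ margins); derivation ours] -/
theorem min_distT_le_distW
    (hlevW : ∀ x ∈ DeepS t x₀ 0, D₁.lev (toBox hN₁ (eS t x₀ x) : Fin (d + 1) → ℤ) = D.lev (toBox hN x))
    (hal : ∀ μ, (((ℓ + 1) ^ k₁ : ℕ) : ℤ) ∣ x₀ μ) (hMh : 1 ≤ Mh) (hP : ∀ μ, 1 ≤ P' μ) {y y' : ↥(bset D.toDomains)} {D₀ : ℝ}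
    (hface : ∀ a ∈ B6GluedDistWindow.FaceBlk (m := m) (K := K) hN D t x₀, D₀ ≤ (geomTB D).dist y a + 1) :
    min ((geomTB D).dist y y') D₀ ≤ (geomW hN D hx₀ hfit hN₁ D₁).dist y y' :=
  B6GluedDistWindow.le_distW_of_far hN D hx₀ hfit hN₁ D₁ hlevW hal hMh hP (min_le_left _ _)
    (fun a ha => (min_le_right _ _).trans (hface a ha))

end Located

/-! ## §4  The bond-window transplant of `∂_□T∂*_□` between deep cut-offs IS `∂·(site-window transplant of T)·∂*` -/

section Sandwich

variable {a₀ a₁ : ℝ} {t : TSIdx d (ℓ + 1) hd hL a₀ a₁} {x₀ : Fin (d + 1) → ℤ}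
variable (hx₀ : ∀ μ, 0 ≤ x₀ μ) (hfit : ∀ μ, x₀ μ + (t.P.sitesPerDir 0 : ℕ) ≤ ((PV d ℓ m K hd hL).sitesPerDir 0 : ℕ))

/-- **`ζ·ε_B(∂_□T∂*_□)ρ_B·h = ζ·∂(ε_S T ρ_S)∂*·h`** for bond cut-offs `ζ`, `h` of margin `1` and one fine factor `c` on both carriers: between deep
cut-offs the bond-window transplant of the member's `∂_□T∂*_□` (r03's `P_l(□)` is of this form) equals the global stencils around the site-window
transplant of `T` (the form of `line3_window`). [cite: Balaban1984PropagatorsII, (2.7)–(2.8) p.224, p.238–239 (operators on `T_□`), (2.92) p.239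
line 3; derivation ours] -/
theorem sandwich_transplant_eq (c : ℝ) (T : Module.End ℝ (Site t.P 0 → ℝ)) (ζ h : PBond (PV d ℓ m K hd hL) 0 → ℝ)
    (hζ : ∀ b, ζ b ≠ 0 → b.src ∈ DeepS t x₀ 1) (hh : ∀ b, h b ≠ 0 → b.src ∈ DeepS t x₀ 1) :
    mulOp ζ * transplant (cB t x₀ hx₀ hfit).W (eB t x₀) (onFun (dE (P := t.P) c) ∘ₗ T ∘ₗ onFun (dsE (P := t.P) c)) * mulOp h =
      mulOp ζ * ((onFun (dE (P := PV d ℓ m K hd hL) c) ∘ₗ transplant (cS t x₀ hx₀ hfit).W (eS t x₀) T) ∘ₗ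
        onFun (dsE (P := PV d ℓ m K hd hL) c)) * mulOp h := by
  classical
  apply LinearMap.ext; intro A; funext b
  rw [Module.End.mul_apply, Module.End.mul_apply, Module.End.mul_apply, Module.End.mul_apply, mulOp_apply, mulOp_apply]
  by_cases hζb : ζ b = 0
  · rw [hζb, zero_mul, zero_mul]
  congr 1
  have hb1 : b.src ∈ DeepS t x₀ 1 := hζ b hζb
  have hbW : b ∈ (cB t x₀ hx₀ hfit).W := mem_cB_W.2 (deepS_mono (by omega) hb1)
  have hA : ∀ b', mulOp h A b' ≠ 0 → b'.src ∈ DeepS t x₀ 1 := fun b' hb' => by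
    rw [mulOp_apply] at hb'
    exact hh b' (left_ne_zero_of_mul hb')
  rw [transplant_apply, if_pos hbW, LinearMap.comp_apply, LinearMap.comp_apply, ← restrictOp_dsE_eq hx₀ hfit c hA,
    LinearMap.comp_apply, LinearMap.comp_apply, ← dE_extendOp_apply hx₀ hfit c _ hb1]
  rfl

end Sandwich

/-! ## §5  Identifying the operators: scales of `∂`, `∂*`; `G′SG′` is independent of the fine factor; the member's `P_□ = G′_□S_□G′_□` -/

section Identify

/-- `∂_c = c·∂_1`. [cite: Balaban1984PropagatorsII, (2.7) p.224] -/
theorem dE_eq_smul {P : Params} (c : ℝ) : dE (P := P) c = c • dE (P := P) 1 := by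
  apply LinearMap.ext; intro f; apply PiLp.ext; intro b
  rw [LinearMap.smul_apply, PiLp.smul_apply, B6SectAOperatorsV1.dE_apply, B6SectAOperatorsV1.dE_apply]
  simp only [LatticeFieldCalculus.grad, smul_eq_mul, one_mul]

/-- `∂*_c = c·∂*_1`. [cite: Balaban1984PropagatorsII, (2.8) p.224] -/
theorem dsE_eq_smul {P : Params} (c : ℝ) : dsE (P := P) c = c • dsE (P := P) 1 := by
  apply LinearMap.ext; intro A; apply PiLp.ext; intro x
  rw [LinearMap.smul_apply, PiLp.smul_apply, B6SectAOperatorsV1.dsE_apply, B6SectAOperatorsV1.dsE_apply]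
  simp only [LatticeFieldCalculus.diverg, smul_eq_mul, Finset.mul_sum, one_mul]

/-- **RESCALING THE STENCILS**: `∂_{c′}A∂*_{c′} = (c′/c)²·∂_cA∂*_c` as bond operators (r03's `s(□) = (c_f/L^{j₀})²` is this factor between the
member's own fine factor `L^{j₀}` and the global `c_f`). [cite: Balaban1984PropagatorsII, (2.7)–(2.8) p.224, (2.92) p.239; bookkeeping] -/
theorem onFun_dE_dsE_rescale {P : Params} {c : ℝ} (hc : c ≠ 0) (c' : ℝ) (A : B6SectAOperatorsV1.ScalarSpace P →ₗ[ℝ] B6SectAOperatorsV1.ScalarSpace P) :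
    onFun (dE (P := P) c' ∘ₗ A ∘ₗ dsE (P := P) c') = (c' / c) ^ 2 • onFun (dE (P := P) c ∘ₗ A ∘ₗ dsE (P := P) c) := by
  rw [dE_eq_smul c', dsE_eq_smul c', dE_eq_smul c, dsE_eq_smul c]
  simp only [LinearMap.smul_comp, LinearMap.comp_smul, onFun_smul, smul_smul]
  congr 1
  field_simp

variable {Mh k R : ℕ} {P' : Fin (d + 1) → ℕ}
variable (hN : ∀ μ, N0 ℓ Mh k P' μ = (PV d ℓ m K hd hL).sitesPerDir 0) (D : TDomains d ℓ Mh k P' R)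

/-- **`G′SG′` DOES NOT DEPEND ON THE FINE FACTOR** (`c⁻²·c⁴·c⁻² = 1`: it is p21's `pM` through the chart).
[cite: Balaban1984PropagatorsII, (2.17) p.225; bookkeeping] -/
theorem GSG_indep {c c' : ℝ} (hc : c ≠ 0) (hc' : c' ≠ 0) :
    GpV hN D c * SV hN D c * GpV hN D c = GpV hN D c' * SV hN D c' * GpV hN D c' := by
  have key : ∀ {c : ℝ}, c ≠ 0 → GpV hN D c * SV hN D c * GpV hN D c =
      chartOp hN (B6Ineq288MultiLevelTorus.GT D * (B6Ineq288MultiLevelTorus.QsM D * B6Ineq288MultiLevelTorus.GiM D *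
        B6Ineq288MultiLevelTorus.QM D) * B6Ineq288MultiLevelTorus.GT D) := by
    intro c hc
    unfold GpV SV
    rw [smul_mul_smul_comm, smul_mul_smul_comm, ← chartOp_mul, ← chartOp_mul]
    have e : (c ^ 2)⁻¹ * c ^ 4 * (c ^ 2)⁻¹ = 1 := by field_simp
    rw [e, one_smul]
  rw [key hc, key hc']

omit hN D in
/-- **THE MEMBER's `P_□` IS `G′_□S_□G′_□` OF ITS p21 FAMILY** on functions, for ANY fine factor `c′` on the right (`B6MemberTorusTDomainsV1.tsV1_P_chart`
in operator form): `onFun (tsV1 …).P = GpV·SV·GpV` of `D_□ = famOf M′ j P₁ R₁ hj Λ′`, `Λ′` big-block saturated.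
[cite: Balaban1984PropagatorsII, (2.17) p.225, (2.90) p.239; derivation ours] -/
theorem onFun_tsV1_P {mt Kt j Mh₁ R₁ : ℕ} {P₁ : Fin (d + 1) → ℕ} (hN₁ : ∀ μ, N0 ℓ Mh₁ (j + 1) P₁ μ = (PV d ℓ mt Kt hd hL).sitesPerDir 0)
    (hk₁ : j + 1 ≤ mt + Kt) (hj : 1 ≤ j) (Λ' : Finset (Site (PV d ℓ mt Kt hd hL) (j + 1)))
    (hsat : ∀ Y Y' : Site (PV d ℓ mt Kt hd hL) (j + 1), B6MemberTorusTDomainsV1.bigLab Mh₁ Y = B6MemberTorusTDomainsV1.bigLab Mh₁ Y' → (Y ∈ Λ' ↔ Y' ∈ Λ'))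
    (hMh₁ : 1 ≤ Mh₁) (hP₁ : ∀ μ, 1 ≤ P₁ μ) {c : ℝ} (hc : c ≠ 0) (w : B6SectCTwoScaleV1.CIdx j Λ' → ℝ) {c' : ℝ} (hc' : c' ≠ 0) :
    onFun (B6SectCTwoScaleV1Lattice.tsV1 (P := PV d ℓ mt Kt hd hL) hc Λ' w).P =
      GpV hN₁ (B6MemberTorusTDomainsV1.famOf Mh₁ j P₁ R₁ hj Λ') c' * SV hN₁ (B6MemberTorusTDomainsV1.famOf Mh₁ j P₁ R₁ hj Λ') c' *
        GpV hN₁ (B6MemberTorusTDomainsV1.famOf Mh₁ j P₁ R₁ hj Λ') c' := by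
  have hℓ : 1 ≤ ℓ := by have := hL.2; omega
  have eP : (B6SectCTwoScaleV1Lattice.tsV1 (P := PV d ℓ mt Kt hd hL) hc Λ' w).P =
      LinearMap.id - (B6SectCTwoScaleV1Lattice.tsV1 (P := PV d ℓ mt Kt hd hL) hc Λ' w).R := rfl
  rw [eP, B6Eq2129TwoScaleV1.R_eq hc hk₁ Λ' (w := w), ← B6MemberTorusTDomainsV1.domT_twoLevelT_of_sat hN₁ hk₁ hj Λ' hsat,
    ← GSG_indep hN₁ _ hc hc']
  exact onFun_oneSubRE_eq hN₁ _ hk₁ hℓ hMh₁ hP₁ hc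

end Identify

/-! ## §6  The operator PRE-IDENTIFIED for the p21 member family `famOf`: global `∂(1 − R)∂*`, member `(c_f/L^j)²·ε_B(∂_□P_□∂*_□)ρ_B`
(r03's `Pl` up to the torus translation, `B6CubeInDecayV1.Pl_eq`) — so that the cube assembly does no operator algebra -/

section MemberForm

variable {Mh k R : ℕ} {P' : Fin (d + 1) → ℕ}
variable (hN : ∀ μ, N0 ℓ Mh k P' μ = (PV d ℓ m K hd hL).sitesPerDir 0) (D : TDomains d ℓ Mh k P' R) (hk : k ≤ m + K)
variable {a₀ a₁ : ℝ} {t : TSIdx d (ℓ + 1) hd hL a₀ a₁} {x₀ : Fin (d + 1) → ℤ}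
variable (hx₀ : ∀ μ, 0 ≤ x₀ μ) (hfit : ∀ μ, x₀ μ + (t.P.sitesPerDir 0 : ℕ) ≤ ((PV d ℓ m K hd hL).sitesPerDir 0 : ℕ))
variable {Mh₁ R₁ : ℕ} {P₁ : Fin (d + 1) → ℕ}
variable (hN₁ : ∀ μ, N0 ℓ Mh₁ (t.j + 1) P₁ μ = (PV d ℓ t.m t.K hd hL).sitesPerDir 0) (hj1 : 1 ≤ t.j)

/-- **THE OPERATOR OF `line3_window` IDENTIFIED** for the member family `D_□ = famOf M′ j P₁ R₁ hj Λ′(t)` (`Λ′` big-block saturated): between bond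
cut-offs `ζ`, `h` of margin `1`,
`ζ·∂_{c_f}(G′SG′ − G̃′_□S̃_□G̃′_□)∂*_{c_f}·h = ζ·(∂_{c_f}(1 − R)∂*_{c_f} − (c_f/L^j)²·ε_B(∂_□P_□∂*_□)ρ_B)·h`
— global: `G′SG′ = 1 − RE` (`B6ScalarFactorsChartV1.onFun_oneSubRE_eq`); member: `transplant_GSG`, `onFun_tsV1_P` (`P_□ = G′_□S_□G′_□`),
`sandwich_transplant_eq` (bond window ↔ site window between deep cut-offs), `onFun_dE_dsE_rescale` (`∂_{c_f} = (c_f/L^j)·∂_{L^j}`).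
[cite: Balaban1984PropagatorsII, (2.92) p.239 line 3, (2.17) p.225, (2.90) p.239, (2.7)–(2.8) p.224; derivation ours] -/
theorem line3_operator_eq
    (hsat : ∀ Y Y' : Site (PV d ℓ t.m t.K hd hL) (t.j + 1),
      B6MemberTorusTDomainsV1.bigLab Mh₁ Y = B6MemberTorusTDomainsV1.bigLab Mh₁ Y' → (Y ∈ t.Λ' ↔ Y' ∈ t.Λ'))
    (hℓ : 1 ≤ ℓ) (hMh : 1 ≤ Mh) (hP : ∀ μ, 1 ≤ P' μ) (hMh₁ : 1 ≤ Mh₁) (hP₁ : ∀ μ, 1 ≤ P₁ μ) {cf : ℝ} (hcf : cf ≠ 0)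
    (ζ h : PBond (PV d ℓ m K hd hL) 0 → ℝ) (hζd : ∀ b, ζ b ≠ 0 → b.src ∈ DeepS t x₀ 1) (hhd : ∀ b, h b ≠ 0 → b.src ∈ DeepS t x₀ 1) :
    mulOp ζ * ((onFun (dE (P := PV d ℓ m K hd hL) cf) ∘ₗ
        (GpV hN D cf * SV hN D cf * GpV hN D cf -
          transplant (cS t x₀ hx₀ hfit).W (eS t x₀) (GpV hN₁ (B6MemberTorusTDomainsV1.famOf Mh₁ t.j P₁ R₁ hj1 t.Λ') cf) *
            transplant (cS t x₀ hx₀ hfit).W (eS t x₀) (SV hN₁ (B6MemberTorusTDomainsV1.famOf Mh₁ t.j P₁ R₁ hj1 t.Λ') cf) *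
            transplant (cS t x₀ hx₀ hfit).W (eS t x₀) (GpV hN₁ (B6MemberTorusTDomainsV1.famOf Mh₁ t.j P₁ R₁ hj1 t.Λ') cf))) ∘ₗ
        onFun (dsE (P := PV d ℓ m K hd hL) cf)) * mulOp h =
      mulOp ζ * (onFun (dE (P := PV d ℓ m K hd hL) cf ∘ₗ (LinearMap.id - B6SectAOperatorsV1.RE (B6GlobalChartV1.domT hN D hk) cf) ∘ₗ
            dsE (P := PV d ℓ m K hd hL) cf) -
        (cf / (((ℓ + 1 : ℕ) : ℝ)) ^ t.j) ^ 2 •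
          transplant (cB t x₀ hx₀ hfit).W (eB t x₀) (onFun (t.D.grad ∘ₗ t.D.P ∘ₗ t.D.dv))) * mulOp h := by
  -- fold the global five-factor form, the member transplant and the member's `P_□`
  rw [← onFun_oneSubRE_eq hN D hk hℓ hMh hP hcf, ← B6ScalarAgreeV1Chart.transplant_GSG hx₀ hfit hN₁ _ cf,
    ← onFun_tsV1_P hN₁ t.hj hj1 t.Λ' hsat hMh₁ hP₁ t.hc t.w hcf]
  -- distribute the sandwich over the difference
  rw [LinearMap.comp_sub, LinearMap.sub_comp, mul_sub, sub_mul, mul_sub, sub_mul]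
  congr 1
  -- the member term: bond window ↔ site window, then rescale the stencils to the member's own `L^j`
  rw [← sandwich_transplant_eq hx₀ hfit cf _ ζ h hζd hhd]
  congr 2
  rw [← onFun_comp, ← onFun_comp, onFun_dE_dsE_rescale t.hc cf, B6Prop26ReachTransplant.transplant_smul]
  rfl

set_option maxHeartbeats 1600000 in
/-- **(2.92) LINE 3 ON THE WINDOW, MEMBER FORM** — `line3_window` for the p21 member family `D_□ := famOf M′ j P₁ R₁ hj Λ′(t)` (levels `j`, `j+1`;
`k₁ = j + 1`, `j_lo = j`, so `Λ = L³`) with the operator PRE-IDENTIFIED by `line3_operator_eq`: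
`ζ·(∂_{c_f}(1 − R E)∂*_{c_f} − (c_f/L^j)²·ε_B(∂_□P_□∂*_□)ρ_B)·h` has the all-pairs block majorant `C_D·e^{−δ′M₀/96}·c_f²/len(y)²·e^{−δ′d′(y,y″)/192}`
on the glued geometry. For r03's cube member `t := tC …`: `hsat := B6MemberLevelsWindow.lam_tOf_sat`, `hlevW := lev_famOf_tOf`, `hal` from the corner,
and `Pl = TB(−v)·((c_f/L^{j₀})² • ε_B(∂_□P_□∂*_□)ρ_B)·TB(v)` (`B6CubeInDecayV1.Pl_eq`). [cite: Balaban1984PropagatorsII, (2.92) p.239 line 3, (2.134) p.247,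
p.238; assembly ours] -/
theorem line3_window_member (d ℓ : ℕ) (hd : 1 ≤ d + 1) (hL : Odd (ℓ + 1) ∧ 1 < ℓ + 1) :
    ∃ M₁ δ C : ℝ, 0 < M₁ ∧ 0 < δ ∧ 0 < C ∧
      ∀ (m K : ℕ) {Mh k R : ℕ} {P' : Fin (d + 1) → ℕ} (hN : ∀ μ, N0 ℓ Mh k P' μ = (PV d ℓ m K hd hL).sitesPerDir 0)
        (D : TDomains d ℓ Mh k P' R) (hk : k ≤ m + K)
        {a₀ a₁ : ℝ} {t : TSIdx d (ℓ + 1) hd hL a₀ a₁} {x₀ : Fin (d + 1) → ℤ}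
        (hx₀ : ∀ μ, 0 ≤ x₀ μ) (hfit : ∀ μ, x₀ μ + (t.P.sitesPerDir 0 : ℕ) ≤ ((PV d ℓ m K hd hL).sitesPerDir 0 : ℕ))
        {Mh₁ R₁ : ℕ} {P₁ : Fin (d + 1) → ℕ} (hN₁ : ∀ μ, N0 ℓ Mh₁ (t.j + 1) P₁ μ = (PV d ℓ t.m t.K hd hL).sitesPerDir 0)
        (hj1 : 1 ≤ t.j)
        (hsat : ∀ Y Y' : Site (PV d ℓ t.m t.K hd hL) (t.j + 1),
          B6MemberTorusTDomainsV1.bigLab Mh₁ Y = B6MemberTorusTDomainsV1.bigLab Mh₁ Y' → (Y ∈ t.Λ' ↔ Y' ∈ t.Λ'))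
        (hlevW : ∀ x ∈ DeepS t x₀ 0, (B6MemberTorusTDomainsV1.famOf Mh₁ t.j P₁ R₁ hj1 t.Λ').lev (toBox hN₁ (eS t x₀ x) : Fin (d + 1) → ℤ) =
          D.lev (toBox hN x))
        (hal : ∀ μ, (((ℓ + 1) ^ (t.j + 1) : ℕ) : ℤ) ∣ x₀ μ)
        (hP4 : ∀ μ, 4 ≤ P' μ) (hR : 2 * (ℓ + 1) ≤ R) (hM : M₁ ≤ ((ℓ : ℝ) + 1) * Mh)
        (hMh₁ : 1 ≤ Mh₁) (hP₁ : ∀ μ, 4 ≤ P₁ μ) (hR₁ : 2 * (ℓ + 1) ≤ R₁) (hM' : M₁ ≤ ((ℓ : ℝ) + 1) * Mh₁)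
        (hRM : 1 ≤ R * ((ℓ + 1) * Mh))
        {κ : ℝ} (hκ : 0 ≤ κ) (hκRM : Real.log ((ℓ : ℝ) + 1) ≤ κ * ((geomTB D).R * (geomTB D).M)) (hκδ : 8 * κ ≤ δ)
        {Kp : ℝ → ℝ} (hPrT : Profile (geomTB D).dist (fun a : ↥(bset D.toDomains) => a) Kp) (hKp0 : ∀ a, 0 < a → 0 ≤ Kp a)
        (hKanti : ∀ a b, 0 < a → a ≤ b → Kp b ≤ Kp a)
        {cf : ℝ} (hcf : cf ≠ 0) (χ cL : Site (PV d ℓ m K hd hL) 0 → ℝ) (N : Finset ↥(bset D.toDomains)) (hNne : N.Nonempty)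
        (hχ0 : ∀ x, 0 ≤ χ x) (hχ1 : ∀ x, χ x ≤ 1) (hχN : ∀ x, blkS hN D x ∉ N → χ x = 1)
        (hχ3 : ∀ x, χ x ≠ 0 → x ∈ DeepS t x₀ 3)
        (hχjump : ∀ b : PBond (PV d ℓ m K hd hL) 0, χ b.tgt ≠ χ b.src → b.src ∈ DeepS t x₀ 1)
        {s₁ s₂ sb : ℝ} (hs₁ : 0 ≤ s₁) (hs₂ : 0 ≤ s₂) (hsb : 0 ≤ sb)
        (hd1 : ∀ b : PBond (PV d ℓ m K hd hL) 0, |χ b.tgt - χ b.src| * (geomTB D).len (blkV1 hN D b) ≤ s₁)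
        (hd1' : ∀ (e : Fin (d + 1) × Bool) (x : Site (PV d ℓ m K hd hL) 0), |χ x - χ (shInv e x)| * (geomTB D).len (blkS hN D x) ≤ s₁)
        (hd2 : ∀ (y : Site (PV d ℓ m K hd hL) 0) (μ : Fin (d + 1)),
          |χ (y.shift μ) - 2 * χ y + χ (y.unshift μ)| * (geomTB D).len (blkS hN D y) ^ 2 ≤ s₂)
        (hdb : ∀ x y : Site (PV d ℓ m K hd hL) 0, blkS hN D x = blkS hN D y → |χ x - χ y| ≤ sb)
        (hNχ : ∀ y : Site (PV d ℓ m K hd hL) 0, blkS hN D y ∉ N →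
          (∀ μ, χ (y.shift μ) = χ y ∧ χ (y.unshift μ) = χ y) ∧ ∀ x, blkS hN D x = blkS hN D y → χ x = χ y)
        (hcL : ∀ x, cL x * χ x = cL x) (ζ h : PBond (PV d ℓ m K hd hL) 0 → ℝ)
        (hζ1 : ∀ b, |ζ b| ≤ 1) (hζd : ∀ b, ζ b ≠ 0 → b.src ∈ DeepS t x₀ 1) (hh1 : ∀ b, |h b| ≤ 1) (hhd : ∀ b, h b ≠ 0 → b.src ∈ DeepS t x₀ 1)
        (hEL : (mulOp ζ ∘ₗ onFun (dE (P := PV d ℓ m K hd hL) cf)) ∘ₗ mulOp cL = mulOp ζ ∘ₗ onFun (dE (P := PV d ℓ m K hd hL) cf))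
        {M₀ : ℝ} (hζdeep : ∀ v, ζ v ≠ 0 → ∀ n ∈ N,
          M₀ ≤ (geomW hN D hx₀ hfit hN₁ (B6MemberTorusTDomainsV1.famOf Mh₁ t.j P₁ R₁ hj1 t.Λ')).dist (blkV1 hN D v) n)
        (hhdeep : ∀ v, h v ≠ 0 → ∀ n ∈ N,
          M₀ ≤ (geomW hN D hx₀ hfit hN₁ (B6MemberTorusTDomainsV1.famOf Mh₁ t.j P₁ R₁ hj1 t.Λ')).dist (blkV1 hN D v) n),
        HasMajorant (g := geomW hN D hx₀ hfit hN₁ (B6MemberTorusTDomainsV1.famOf Mh₁ t.j P₁ R₁ hj1 t.Λ')) (blkV1 hN D)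
          (mulOp ζ * (onFun (dE (P := PV d ℓ m K hd hL) cf ∘ₗ (LinearMap.id - B6SectAOperatorsV1.RE (B6GlobalChartV1.domT hN D hk) cf) ∘ₗ
                dsE (P := PV d ℓ m K hd hL) cf) -
            (cf / (((ℓ + 1 : ℕ) : ℝ)) ^ t.j) ^ 2 •
              transplant (cB t x₀ hx₀ hfit).W (eB t x₀) (onFun (t.D.grad ∘ₗ t.D.P ∘ₗ t.D.dv))) * mulOp h)
          (fun a b => CDgk (((ℓ : ℝ) + 1) ^ 3) C C (((d : ℝ) + 1) * C)
              (((d : ℝ) + 1) * (s₁ * C * (1 + Real.exp δ) + s₂ * C) + sb * C)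
              ((((Finset.univ : Finset (Fin (d + 1) × Bool)).card : ℝ) *
                  ((((ℓ : ℝ) + 1) ^ 3) * (|cf| * s₁) *
                      (Real.exp (1 + δ) * Kp 1 * |cf|⁻¹ * (((d : ℝ) + 1) * |cf|⁻¹ * C) * |cf|) +
                    (((ℓ : ℝ) + 1) ^ 3) ^ 2 * 0 * C) +
                (((ℓ : ℝ) + 1) ^ 3) ^ 2 * (((d : ℝ) + 1) * s₂ + sb) * C) / 1)
              (Kp ((δ - 2 * κ) / 192) *
                (1 + (Fintype.card ↥(bset (B6MemberTorusTDomainsV1.famOf Mh₁ t.j P₁ R₁ hj1 t.Λ').toDomains) : ℝ))) *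
            Real.exp (-((δ - 2 * κ) / 96 * M₀)) /
              ((geomW hN D hx₀ hfit hN₁ (B6MemberTorusTDomainsV1.famOf Mh₁ t.j P₁ R₁ hj1 t.Λ')).len a / |cf|) ^ 2 *
            Real.exp (-((δ - 2 * κ) / 192 *
              (geomW hN D hx₀ hfit hN₁ (B6MemberTorusTDomainsV1.famOf Mh₁ t.j P₁ R₁ hj1 t.Λ')).dist a b))) := by
  obtain ⟨M₁, δ, C, hM₁, hδ, hC, hwin⟩ := line3_window d ℓ hd hL
  refine ⟨M₁, δ, C, hM₁, hδ, hC, ?_⟩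
  intro m K Mh k R P' hN D hk a₀ a₁ t x₀ hx₀ hfit Mh₁ R₁ P₁ hN₁ hj1 hsat hlevW hal hP4 hR hM hMh₁ hP₁ hR₁ hM' hRM κ hκ hκRM hκδ
    Kp hPrT hKp0 hKanti cf hcf χ cL N hNne hχ0 hχ1 hχN hχ3 hχjump s₁ s₂ sb hs₁ hs₂ hsb hd1 hd1' hd2 hdb hNχ hcL ζ h hζ1 hζd hh1 hhd hEL M₀
    hζdeep hhdeep
  have hℓ : 1 ≤ ℓ := by have := hL.2; omega
  have hP1 : ∀ μ, 1 ≤ P' μ := fun μ => le_trans (by norm_num) (hP4 μ)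
  have hP₁1 : ∀ μ, 1 ≤ P₁ μ := fun μ => le_trans (by norm_num) (hP₁ μ)
  have hMh1 : 1 ≤ Mh := by
    by_contra h0
    have : Mh = 0 := by omega
    rw [this, Nat.cast_zero, mul_zero] at hM
    linarith
  have key := hwin m K hN D hk hx₀ hfit hN₁ (B6MemberTorusTDomainsV1.famOf Mh₁ t.j P₁ R₁ hj1 t.Λ') hlevW hal t.hj
    (jlo := t.j) (fun z => B6MemberTorusTDomainsV1.j_le_lev hj1 _ z.1) (Nat.le_succ _) hP4 hR hM hMh₁ hP₁ hR₁ hM' hRM hκ hκRM hκδ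
    hPrT hKp0 hKanti hcf χ cL N hNne hχ0 hχ1 hχN hχ3 hχjump hs₁ hs₂ hsb hd1 hd1' hd2 hdb hNχ hcL ζ h hζ1 hζd hh1 hhd hEL hζdeep hhdeep
  rw [line3_operator_eq hN D hk hx₀ hfit hN₁ hj1 hsat hℓ hMh1 hP1 hMh₁ hP₁1 hcf ζ h hζd hhd] at key
  have e3 : 2 + (t.j + 1 - t.j) = 3 := by omega
  simpa only [e3] using key

end MemberForm

end Literature.MathematicalPhysics.QuantumFieldTheory.Balaban1983to89.B6Line3WindowV1
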